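import Mathlib
import Summits.Ventures.PercRepro2.PrefMonoGlue
import Summits.Ventures.PercRepro2.PrefMonoClasses
import Summits.Ventures.PercRepro2.PrefMonoAlgebra

/-!
# The free-vertex odds theorem `PrefMono.pref_mono` (`PrefMono`, part 3: BHK + the theorem)
(blind cell PercRepro2, mine-c g29; `conjectures/MINE-C.md` §38.4)

The two BHK06 1.4 inequalities with an avoided set (`bhk_cross_cluster_avoid`) in class masses
(`bhk_a`, `bhk_b`), and the theorem: `pref p[e↦t] = P_t(E) P_t(N) / (P_t(Q) P_t(A))` is non-decreasing
in the weight `t ∈ [0, 1]` of an edge `e = {v, y}` at `v` wherever `P_t(A) > 0` (`PrefMonoGlue.lean`'s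
header), with the corollaries `ratio_mono` (`ν(v ∉ C₁)/ν(v ∉ U)` grows) and `free_antitone`
(`ν(v ∉ U)` falls).
-/

namespace Summit.Ventures.PercRepro2

namespace PrefMono

variable {V : Type*} {E : Type*} [Fintype V] [DecidableEq V] [Fintype E] [DecidableEq E]
  {R : Type*} [Field R] [LinearOrder R] [IsStrictOrderedRing R]

section BHK

variable (p : E → R) (ends : E → Sym2 V) (a₁ a₂ v y : V)

/-- **BHK06 1.4 with `{a₂, v}` avoided by `a₁`**, in class masses:
`c₂₁ · P(N) ≤ (c₀₁ + c₂₁) · (c₂₁ + c₂ₙ)`, i.e. `ba ≥ 0`. -/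
lemma bhk_a (hp : IsProbVec p) :
    prob p (Z21 ends a₁ a₂ v y) * prob p (TwoRootLean.NEvent ends a₁ a₂ v) ≤
      (prob p (Z01 ends a₁ a₂ v y) + prob p (Z21 ends a₁ a₂ v y)) *
        (prob p (Z21 ends a₁ a₂ v y) + prob p (Z2n ends a₁ a₂ v y)) := by
  have hU : IsUpperSet {S : Set V | y ∈ S} := fun _ _ hST h => hST h
  have hB : IsUpperSet {S : Set V | v ∈ S} := fun _ _ hST h => hST h
  have key := bhk_cross_cluster_avoid p hp ends a₁ a₂ (X := ({a₂, v} : Finset V))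
    (Finset.mem_insert_self a₂ {v}) hU hB
  have e1 : clusterInEvent ends a₁ {S : Set V | y ∈ S} = connEvent ends a₁ y := by
    ext ω; simp only [mem_clusterInEvent, Set.mem_setOf_eq, mem_cluster, mem_connEvent]
  have e2 : clusterInEvent ends a₂ {S : Set V | v ∈ S} = connEvent ends a₂ v := by
    ext ω; simp only [mem_clusterInEvent, Set.mem_setOf_eq, mem_cluster, mem_connEvent]
  rw [e1, e2] at key
  have hNdef : avoidAll ends a₁ {a₂, v} = TwoRootLean.NEvent ends a₁ a₂ v := rfl
  rw [hNdef] at key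
  have k1 : connEvent ends a₁ y ∩ connEvent ends a₂ v ∩ TwoRootLean.NEvent ends a₁ a₂ v =
      Z21 ends a₁ a₂ v y := by
    ext ω
    rw [Set.mem_inter_iff, Set.mem_inter_iff, mem_Z21, mem_N_iff, mem_connEvent, mem_connEvent]
    constructor
    · rintro ⟨⟨hy, hv2⟩, hQ, hv⟩; exact ⟨hQ, hv, hv2, hy⟩
    · rintro ⟨hQ, hv, hv2, hy⟩; exact ⟨⟨hy, hv2⟩, hQ, hv⟩
  have k2a : connEvent ends a₁ y ∩ TwoRootLean.NEvent ends a₁ a₂ v ∩ connEvent ends a₂ v =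
      Z21 ends a₁ a₂ v y := by
    ext ω
    rw [Set.mem_inter_iff, Set.mem_inter_iff, mem_Z21, mem_N_iff, mem_connEvent, mem_connEvent]
    constructor
    · rintro ⟨⟨hy, hQ, hv⟩, hv2⟩; exact ⟨hQ, hv, hv2, hy⟩
    · rintro ⟨hQ, hv, hv2, hy⟩; exact ⟨⟨hy, hQ, hv⟩, hv2⟩
  have k2b : connEvent ends a₁ y ∩ TwoRootLean.NEvent ends a₁ a₂ v ∩ (connEvent ends a₂ v)ᶜ =
      Z01 ends a₁ a₂ v y := by
    ext ω
    rw [Set.mem_inter_iff, Set.mem_inter_iff, mem_Z01, mem_N_iff, Set.mem_compl_iff,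
      mem_connEvent, mem_connEvent]
    constructor
    · rintro ⟨⟨hy, hQ, hv⟩, hv2⟩; exact ⟨hQ, hv, hv2, hy⟩
    · rintro ⟨hQ, hv, hv2, hy⟩; exact ⟨⟨hy, hQ, hv⟩, hv2⟩
  have k2 : prob p (connEvent ends a₁ y ∩ TwoRootLean.NEvent ends a₁ a₂ v) =
      prob p (Z01 ends a₁ a₂ v y) + prob p (Z21 ends a₁ a₂ v y) := by
    rw [split p _ (connEvent ends a₂ v), k2a, k2b, add_comm]
  have k3 : connEvent ends a₂ v ∩ TwoRootLean.NEvent ends a₁ a₂ v =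
      TwoRootLean.NEvent ends a₁ a₂ v ∩ connEvent ends a₂ v := Set.inter_comm _ _
  rw [k1, k2, k3, M2_eq p ends a₁ a₂ v y] at key
  exact key

/-- **BHK06 1.4 with `{a₁, v}` avoided by `a₂`**, in class masses:
`c₁₂ · (P(E) + P(A)) ≤ (c₀₂ + c₁₂) · P(E)`, i.e. `bb ≥ 0`. -/
lemma bhk_b (hp : IsProbVec p) :
    prob p (Z12 ends a₁ a₂ v y) *
        (prob p (EEvent ends a₁ a₂ v) + prob p (AEvent ends a₁ a₂ v)) ≤
      (prob p (Z02 ends a₁ a₂ v y) + prob p (Z12 ends a₁ a₂ v y)) *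
        prob p (EEvent ends a₁ a₂ v) := by
  have hU : IsUpperSet {S : Set V | y ∈ S} := fun _ _ hST h => hST h
  have hB : IsUpperSet {S : Set V | v ∈ S} := fun _ _ hST h => hST h
  have key := bhk_cross_cluster_avoid p hp ends a₂ a₁ (X := ({a₁, v} : Finset V))
    (Finset.mem_insert_self a₁ {v}) hU hB
  have e1 : clusterInEvent ends a₂ {S : Set V | y ∈ S} = connEvent ends a₂ y := by
    ext ω; simp only [mem_clusterInEvent, Set.mem_setOf_eq, mem_cluster, mem_connEvent]
  have e2 : clusterInEvent ends a₁ {S : Set V | v ∈ S} = connEvent ends a₁ v := by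
    ext ω; simp only [mem_clusterInEvent, Set.mem_setOf_eq, mem_cluster, mem_connEvent]
  rw [e1, e2] at key
  -- the world `N' = {a₂ ↮ a₁, a₂ ↮ v}` in terms of `Q`
  have hN' : ∀ ω : Config E, ω ∈ avoidAll ends a₂ {a₁, v} ↔
      ω ∈ QEvent ends a₁ a₂ ∧ ¬ Conn ends ω a₂ v := by
    intro ω
    simp only [avoidAll, QEvent, Set.mem_setOf_eq, Finset.mem_insert, Finset.mem_singleton,
      forall_eq_or_imp, forall_eq]
    constructor
    · rintro ⟨h1, h2⟩; exact ⟨fun h => h1 (conn_symm h), h2⟩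
    · rintro ⟨h1, h2⟩; exact ⟨fun h => h1 (conn_symm h), h2⟩
  have k1 : connEvent ends a₂ y ∩ connEvent ends a₁ v ∩ avoidAll ends a₂ {a₁, v} =
      Z12 ends a₁ a₂ v y := by
    ext ω
    rw [Set.mem_inter_iff, Set.mem_inter_iff, mem_Z12, hN', mem_connEvent, mem_connEvent]
    constructor
    · rintro ⟨⟨hy, hv⟩, hQ, _⟩; exact ⟨hQ, hv, hy⟩
    · rintro ⟨hQ, hv, hy⟩; exact ⟨⟨hy, hv⟩, hQ, not_conn₂_of_conn₁ hQ hv⟩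
  have k2a : avoidAll ends a₂ {a₁, v} ∩ connEvent ends a₁ v = EEvent ends a₁ a₂ v := by
    ext ω
    rw [Set.mem_inter_iff, hN', mem_E_iff, mem_connEvent]
    constructor
    · rintro ⟨⟨hQ, _⟩, hv⟩; exact ⟨hQ, hv⟩
    · rintro ⟨hQ, hv⟩; exact ⟨⟨hQ, not_conn₂_of_conn₁ hQ hv⟩, hv⟩
  have k2b : avoidAll ends a₂ {a₁, v} ∩ (connEvent ends a₁ v)ᶜ = AEvent ends a₁ a₂ v := by
    ext ω
    rw [Set.mem_inter_iff, hN', mem_A_iff, Set.mem_compl_iff, mem_connEvent]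
    constructor
    · rintro ⟨⟨hQ, hv2⟩, hv⟩; exact ⟨hQ, hv, hv2⟩
    · rintro ⟨hQ, hv, hv2⟩; exact ⟨⟨hQ, hv2⟩, hv⟩
  have k2 : prob p (avoidAll ends a₂ {a₁, v}) =
      prob p (EEvent ends a₁ a₂ v) + prob p (AEvent ends a₁ a₂ v) := by
    rw [split p _ (connEvent ends a₁ v), k2a, k2b]
  have k3a : connEvent ends a₂ y ∩ avoidAll ends a₂ {a₁, v} ∩ connEvent ends a₁ v =
      Z12 ends a₁ a₂ v y := by
    ext ω
    rw [Set.mem_inter_iff, Set.mem_inter_iff, mem_Z12, hN', mem_connEvent, mem_connEvent]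
    constructor
    · rintro ⟨⟨hy, hQ, _⟩, hv⟩; exact ⟨hQ, hv, hy⟩
    · rintro ⟨hQ, hv, hy⟩; exact ⟨⟨hy, hQ, not_conn₂_of_conn₁ hQ hv⟩, hv⟩
  have k3b : connEvent ends a₂ y ∩ avoidAll ends a₂ {a₁, v} ∩ (connEvent ends a₁ v)ᶜ =
      Z02 ends a₁ a₂ v y := by
    ext ω
    rw [Set.mem_inter_iff, Set.mem_inter_iff, mem_Z02, hN', Set.mem_compl_iff, mem_connEvent,
      mem_connEvent]
    constructor
    · rintro ⟨⟨hy, hQ, hv2⟩, hv⟩; exact ⟨hQ, hv, hv2, hy⟩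
    · rintro ⟨hQ, hv, hv2, hy⟩; exact ⟨⟨hy, hQ, hv2⟩, hv⟩
  have k3 : prob p (connEvent ends a₂ y ∩ avoidAll ends a₂ {a₁, v}) =
      prob p (Z02 ends a₁ a₂ v y) + prob p (Z12 ends a₁ a₂ v y) := by
    rw [split p _ (connEvent ends a₁ v), k3a, k3b, add_comm]
  have k4 : connEvent ends a₁ v ∩ avoidAll ends a₂ {a₁, v} = EEvent ends a₁ a₂ v := by
    rw [Set.inter_comm]; exact k2a
  rw [k1, k2, k3, k4] at key
  exact key

end BHK

section Main

variable (p : E → R) (ends : E → Sym2 V) {e : E} {v y : V}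

/-- **The free-vertex odds theorem**: `pref p[e↦t] = P_t(E) P_t(N) / (P_t(Q) P_t(A))` is
non-decreasing in the weight `t ∈ [0, 1]` of an edge `e = {v, y}` at `v`, wherever `P_t(A) > 0`
(for `0 ≤ s ≤ t ≤ 1`). -/
theorem pref_mono (hp : IsProbVec p) (hends : ends e = s(v, y)) (a₁ a₂ : V) {s t : R}
    (hs : 0 ≤ s) (hst : s ≤ t) (ht : t ≤ 1)
    (hAs : 0 < prob (Function.update p e s) (AEvent ends a₁ a₂ v))
    (hAt : 0 < prob (Function.update p e t) (AEvent ends a₁ a₂ v)) :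
    pref (Function.update p e s) ends a₁ a₂ v ≤ pref (Function.update p e t) ends a₁ a₂ v := by
  have hp₀ : IsProbVec (Function.update p e 0) := hp.update e le_rfl zero_le_one
  have hps : IsProbVec (Function.update p e s) := hp.update e hs (le_trans hst ht)
  have hpt : IsProbVec (Function.update p e t) := hp.update e (le_trans hs hst) ht
  -- denominators
  have hQs : 0 < prob (Function.update p e s) (QEvent ends a₁ a₂) :=
    lt_of_lt_of_le hAs (prob_mono hps fun ω hω => (mem_A_iff.1 hω).1)
  have hQt : 0 < prob (Function.update p e t) (QEvent ends a₁ a₂) :=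
    lt_of_lt_of_le hAt (prob_mono hpt fun ω hω => (mem_A_iff.1 hω).1)
  unfold pref
  rw [div_le_div_iff₀ (mul_pos hQs hAs) (mul_pos hQt hAt)]
  -- the class masses of the closed instance
  have h00 : 0 ≤ prob (Function.update p e 0) (Z00 ends a₁ a₂ v y) := prob_nonneg hp₀ _
  have h01 : 0 ≤ prob (Function.update p e 0) (Z01 ends a₁ a₂ v y) := prob_nonneg hp₀ _
  have h02 : 0 ≤ prob (Function.update p e 0) (Z02 ends a₁ a₂ v y) := prob_nonneg hp₀ _
  have h1n : 0 ≤ prob (Function.update p e 0) (Z1n ends a₁ a₂ v y) := prob_nonneg hp₀ _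
  have h12 : 0 ≤ prob (Function.update p e 0) (Z12 ends a₁ a₂ v y) := prob_nonneg hp₀ _
  have h2n : 0 ≤ prob (Function.update p e 0) (Z2n ends a₁ a₂ v y) := prob_nonneg hp₀ _
  have h21 : 0 ≤ prob (Function.update p e 0) (Z21 ends a₁ a₂ v y) := prob_nonneg hp₀ _
  -- the closed masses
  have hE0 := E_eq (Function.update p e 0) ends a₁ a₂ v y
  have hA0 := A_eq (Function.update p e 0) ends a₁ a₂ v y
  have hN0 : prob (Function.update p e 0) (TwoRootLean.NEvent ends a₁ a₂ v) =
      prob (Function.update p e 0) (Z21 ends a₁ a₂ v y) +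
        prob (Function.update p e 0) (Z2n ends a₁ a₂ v y) +
        (prob (Function.update p e 0) (Z01 ends a₁ a₂ v y) +
          prob (Function.update p e 0) (Z02 ends a₁ a₂ v y) +
          prob (Function.update p e 0) (Z00 ends a₁ a₂ v y)) := by
    rw [N_eq_M2_add_A (Function.update p e 0) ends a₁ a₂ v,
      M2_eq (Function.update p e 0) ends a₁ a₂ v y, hA0]
  have hQ0 : prob (Function.update p e 0) (QEvent ends a₁ a₂) =
      prob (Function.update p e 0) (Z1n ends a₁ a₂ v y) +
        prob (Function.update p e 0) (Z12 ends a₁ a₂ v y) +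
        (prob (Function.update p e 0) (Z21 ends a₁ a₂ v y) +
          prob (Function.update p e 0) (Z2n ends a₁ a₂ v y) +
          (prob (Function.update p e 0) (Z01 ends a₁ a₂ v y) +
            prob (Function.update p e 0) (Z02 ends a₁ a₂ v y) +
            prob (Function.update p e 0) (Z00 ends a₁ a₂ v y))) := by
    rw [Q_eq_E_add_N (Function.update p e 0) ends a₁ a₂ v, hE0, hN0]
  -- the glued masses
  have hE1 := E_one p ends a₁ a₂ hends
  have hN1 := N_one p ends a₁ a₂ hends
  have hQ1 := Q_one p ends a₁ a₂ hends
  have hA1 := A_one p ends a₁ a₂ hends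
  -- the two BHK inequalities
  have hba : 0 ≤ (prob (Function.update p e 0) (Z2n ends a₁ a₂ v y) +
      prob (Function.update p e 0) (Z21 ends a₁ a₂ v y)) *
        prob (Function.update p e 0) (Z01 ends a₁ a₂ v y) -
      (prob (Function.update p e 0) (Z01 ends a₁ a₂ v y) +
        prob (Function.update p e 0) (Z02 ends a₁ a₂ v y) +
        prob (Function.update p e 0) (Z00 ends a₁ a₂ v y)) *
        prob (Function.update p e 0) (Z21 ends a₁ a₂ v y) := by
    have := bhk_a (Function.update p e 0) ends a₁ a₂ v y hp₀
    rw [hN0] at this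
    linarith [this]
  have hbb : 0 ≤ (prob (Function.update p e 0) (Z1n ends a₁ a₂ v y) +
      prob (Function.update p e 0) (Z12 ends a₁ a₂ v y)) *
        prob (Function.update p e 0) (Z02 ends a₁ a₂ v y) -
      (prob (Function.update p e 0) (Z01 ends a₁ a₂ v y) +
        prob (Function.update p e 0) (Z02 ends a₁ a₂ v y) +
        prob (Function.update p e 0) (Z00 ends a₁ a₂ v y)) *
        prob (Function.update p e 0) (Z12 ends a₁ a₂ v y) := by
    have := bhk_b (Function.update p e 0) ends a₁ a₂ v y hp₀
    rw [hE0, hA0] at this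
    linarith [this]
  -- pin the masses at `s` and `t`
  rw [OneRootDrop.prob_update_eq_pin p s (EEvent ends a₁ a₂ v),
    OneRootDrop.prob_update_eq_pin p s (TwoRootLean.NEvent ends a₁ a₂ v),
    OneRootDrop.prob_update_eq_pin p s (QEvent ends a₁ a₂),
    OneRootDrop.prob_update_eq_pin p s (AEvent ends a₁ a₂ v),
    OneRootDrop.prob_update_eq_pin p t (EEvent ends a₁ a₂ v),
    OneRootDrop.prob_update_eq_pin p t (TwoRootLean.NEvent ends a₁ a₂ v),
    OneRootDrop.prob_update_eq_pin p t (QEvent ends a₁ a₂),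
    OneRootDrop.prob_update_eq_pin p t (AEvent ends a₁ a₂ v), hE0, hN0, hQ0, hA0, hE1, hN1, hQ1,
    hA1]
  exact core _ _ _ _ _ _ _ s t h00 h01 h02 h1n h12 h2n h21 hs hst ht hba hbb


/-- **Corollary (the odds factor of the drop form)**: `P_t(N) / P_t(A) = ν(v ∉ C₁) / ν(v ∉ U)` is
non-decreasing in the weight `t` of an edge `e = {v, y}` at `v` (for `s ≤ t`, wherever `P_s(A), P_t(A) > 0`). -/
theorem ratio_mono (hp : IsProbVec p) (hends : ends e = s(v, y)) (a₁ a₂ : V) {s t : R}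
    (hst : s ≤ t)
    (hAs : 0 < prob (Function.update p e s) (AEvent ends a₁ a₂ v))
    (hAt : 0 < prob (Function.update p e t) (AEvent ends a₁ a₂ v)) :
    prob (Function.update p e s) (TwoRootLean.NEvent ends a₁ a₂ v) /
        prob (Function.update p e s) (AEvent ends a₁ a₂ v) ≤
      prob (Function.update p e t) (TwoRootLean.NEvent ends a₁ a₂ v) /
        prob (Function.update p e t) (AEvent ends a₁ a₂ v) := by
  have hp₀ : IsProbVec (Function.update p e 0) := hp.update e le_rfl zero_le_one
  rw [div_le_div_iff₀ hAs hAt]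
  have h00 : 0 ≤ prob (Function.update p e 0) (Z00 ends a₁ a₂ v y) := prob_nonneg hp₀ _
  have h01 : 0 ≤ prob (Function.update p e 0) (Z01 ends a₁ a₂ v y) := prob_nonneg hp₀ _
  have h02 : 0 ≤ prob (Function.update p e 0) (Z02 ends a₁ a₂ v y) := prob_nonneg hp₀ _
  have h2n : 0 ≤ prob (Function.update p e 0) (Z2n ends a₁ a₂ v y) := prob_nonneg hp₀ _
  have h21 : 0 ≤ prob (Function.update p e 0) (Z21 ends a₁ a₂ v y) := prob_nonneg hp₀ _
  have hA0 := A_eq (Function.update p e 0) ends a₁ a₂ v y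
  have hN0 : prob (Function.update p e 0) (TwoRootLean.NEvent ends a₁ a₂ v) =
      prob (Function.update p e 0) (Z21 ends a₁ a₂ v y) +
        prob (Function.update p e 0) (Z2n ends a₁ a₂ v y) +
        (prob (Function.update p e 0) (Z01 ends a₁ a₂ v y) +
          prob (Function.update p e 0) (Z02 ends a₁ a₂ v y) +
          prob (Function.update p e 0) (Z00 ends a₁ a₂ v y)) := by
    rw [N_eq_M2_add_A (Function.update p e 0) ends a₁ a₂ v,
      M2_eq (Function.update p e 0) ends a₁ a₂ v y, hA0]
  have hN1 := N_one p ends a₁ a₂ hends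
  have hA1 := A_one p ends a₁ a₂ hends
  have hba : 0 ≤ (prob (Function.update p e 0) (Z2n ends a₁ a₂ v y) +
      prob (Function.update p e 0) (Z21 ends a₁ a₂ v y)) *
        prob (Function.update p e 0) (Z01 ends a₁ a₂ v y) -
      (prob (Function.update p e 0) (Z01 ends a₁ a₂ v y) +
        prob (Function.update p e 0) (Z02 ends a₁ a₂ v y) +
        prob (Function.update p e 0) (Z00 ends a₁ a₂ v y)) *
        prob (Function.update p e 0) (Z21 ends a₁ a₂ v y) := by
    have := bhk_a (Function.update p e 0) ends a₁ a₂ v y hp₀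
    rw [hN0] at this
    linarith [this]
  rw [OneRootDrop.prob_update_eq_pin p s (TwoRootLean.NEvent ends a₁ a₂ v),
    OneRootDrop.prob_update_eq_pin p s (AEvent ends a₁ a₂ v),
    OneRootDrop.prob_update_eq_pin p t (TwoRootLean.NEvent ends a₁ a₂ v),
    OneRootDrop.prob_update_eq_pin p t (AEvent ends a₁ a₂ v), hN0, hA0, hN1, hA1]
  set c00 := prob (Function.update p e 0) (Z00 ends a₁ a₂ v y)
  set c01 := prob (Function.update p e 0) (Z01 ends a₁ a₂ v y)
  set c02 := prob (Function.update p e 0) (Z02 ends a₁ a₂ v y)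
  set c2n := prob (Function.update p e 0) (Z2n ends a₁ a₂ v y)
  set c21 := prob (Function.update p e 0) (Z21 ends a₁ a₂ v y)
  -- `N₁ A₀ − N₀ A₁ = ba + c₀₂ (c₀₀ + c₀₁ + c₀₂ + c₂ₙ + c₂₁) ≥ 0`
  have hkey : 0 ≤ (c00 + c02 + c2n) * (c01 + c02 + c00) - (c21 + c2n + (c01 + c02 + c00)) * c00 := by
    have : (c00 + c02 + c2n) * (c01 + c02 + c00) - (c21 + c2n + (c01 + c02 + c00)) * c00 =
        ((c2n + c21) * c01 - (c01 + c02 + c00) * c21) + c02 * (c00 + c01 + c02 + c2n + c21) := by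
      ring
    rw [this]
    exact add_nonneg hba (mul_nonneg h02 (by positivity))
  have hts : 0 ≤ t - s := by linarith
  have hid : (t * (c00 + c02 + c2n) + (1 - t) * (c21 + c2n + (c01 + c02 + c00))) *
        (s * c00 + (1 - s) * (c01 + c02 + c00)) -
      (s * (c00 + c02 + c2n) + (1 - s) * (c21 + c2n + (c01 + c02 + c00))) *
        (t * c00 + (1 - t) * (c01 + c02 + c00)) =
      (t - s) * ((c00 + c02 + c2n) * (c01 + c02 + c00) - (c21 + c2n + (c01 + c02 + c00)) * c00) := by
    ring
  linarith only [mul_nonneg hts hkey, hid]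

/-- **Corollary (the free-vertex mass)**: `P_t(A) / P_t(Q) = ν(v ∉ C₁ ∪ C₂)` is non-increasing in the
weight `t` of an edge `e = {v, y}` at `v` (for `s ≤ t`, wherever `P_s(Q), P_t(Q) > 0`). -/
theorem free_antitone (hp : IsProbVec p) (hends : ends e = s(v, y)) (a₁ a₂ : V) {s t : R}
    (hst : s ≤ t)
    (hQs : 0 < prob (Function.update p e s) (QEvent ends a₁ a₂))
    (hQt : 0 < prob (Function.update p e t) (QEvent ends a₁ a₂)) :
    prob (Function.update p e t) (AEvent ends a₁ a₂ v) /
        prob (Function.update p e t) (QEvent ends a₁ a₂) ≤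
      prob (Function.update p e s) (AEvent ends a₁ a₂ v) /
        prob (Function.update p e s) (QEvent ends a₁ a₂) := by
  have hp₀ : IsProbVec (Function.update p e 0) := hp.update e le_rfl zero_le_one
  rw [div_le_div_iff₀ hQt hQs]
  have h00 : 0 ≤ prob (Function.update p e 0) (Z00 ends a₁ a₂ v y) := prob_nonneg hp₀ _
  have h01 : 0 ≤ prob (Function.update p e 0) (Z01 ends a₁ a₂ v y) := prob_nonneg hp₀ _
  have h02 : 0 ≤ prob (Function.update p e 0) (Z02 ends a₁ a₂ v y) := prob_nonneg hp₀ _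
  have h1n : 0 ≤ prob (Function.update p e 0) (Z1n ends a₁ a₂ v y) := prob_nonneg hp₀ _
  have h12 : 0 ≤ prob (Function.update p e 0) (Z12 ends a₁ a₂ v y) := prob_nonneg hp₀ _
  have h2n : 0 ≤ prob (Function.update p e 0) (Z2n ends a₁ a₂ v y) := prob_nonneg hp₀ _
  have h21 : 0 ≤ prob (Function.update p e 0) (Z21 ends a₁ a₂ v y) := prob_nonneg hp₀ _
  have hE0 := E_eq (Function.update p e 0) ends a₁ a₂ v y
  have hA0 := A_eq (Function.update p e 0) ends a₁ a₂ v y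
  have hN0 : prob (Function.update p e 0) (TwoRootLean.NEvent ends a₁ a₂ v) =
      prob (Function.update p e 0) (Z21 ends a₁ a₂ v y) +
        prob (Function.update p e 0) (Z2n ends a₁ a₂ v y) +
        (prob (Function.update p e 0) (Z01 ends a₁ a₂ v y) +
          prob (Function.update p e 0) (Z02 ends a₁ a₂ v y) +
          prob (Function.update p e 0) (Z00 ends a₁ a₂ v y)) := by
    rw [N_eq_M2_add_A (Function.update p e 0) ends a₁ a₂ v,
      M2_eq (Function.update p e 0) ends a₁ a₂ v y, hA0]
  have hQ0 : prob (Function.update p e 0) (QEvent ends a₁ a₂) =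
      prob (Function.update p e 0) (Z1n ends a₁ a₂ v y) +
        prob (Function.update p e 0) (Z12 ends a₁ a₂ v y) +
        (prob (Function.update p e 0) (Z21 ends a₁ a₂ v y) +
          prob (Function.update p e 0) (Z2n ends a₁ a₂ v y) +
          (prob (Function.update p e 0) (Z01 ends a₁ a₂ v y) +
            prob (Function.update p e 0) (Z02 ends a₁ a₂ v y) +
            prob (Function.update p e 0) (Z00 ends a₁ a₂ v y))) := by
    rw [Q_eq_E_add_N (Function.update p e 0) ends a₁ a₂ v, hE0, hN0]
  have hQ1 := Q_one p ends a₁ a₂ hends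
  have hA1 := A_one p ends a₁ a₂ hends
  have hba : 0 ≤ (prob (Function.update p e 0) (Z2n ends a₁ a₂ v y) +
      prob (Function.update p e 0) (Z21 ends a₁ a₂ v y)) *
        prob (Function.update p e 0) (Z01 ends a₁ a₂ v y) -
      (prob (Function.update p e 0) (Z01 ends a₁ a₂ v y) +
        prob (Function.update p e 0) (Z02 ends a₁ a₂ v y) +
        prob (Function.update p e 0) (Z00 ends a₁ a₂ v y)) *
        prob (Function.update p e 0) (Z21 ends a₁ a₂ v y) := by
    have := bhk_a (Function.update p e 0) ends a₁ a₂ v y hp₀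
    rw [hN0] at this
    linarith [this]
  have hbb : 0 ≤ (prob (Function.update p e 0) (Z1n ends a₁ a₂ v y) +
      prob (Function.update p e 0) (Z12 ends a₁ a₂ v y)) *
        prob (Function.update p e 0) (Z02 ends a₁ a₂ v y) -
      (prob (Function.update p e 0) (Z01 ends a₁ a₂ v y) +
        prob (Function.update p e 0) (Z02 ends a₁ a₂ v y) +
        prob (Function.update p e 0) (Z00 ends a₁ a₂ v y)) *
        prob (Function.update p e 0) (Z12 ends a₁ a₂ v y) := by
    have := bhk_b (Function.update p e 0) ends a₁ a₂ v y hp₀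
    rw [hE0, hA0] at this
    linarith [this]
  rw [OneRootDrop.prob_update_eq_pin p s (QEvent ends a₁ a₂),
    OneRootDrop.prob_update_eq_pin p s (AEvent ends a₁ a₂ v),
    OneRootDrop.prob_update_eq_pin p t (QEvent ends a₁ a₂),
    OneRootDrop.prob_update_eq_pin p t (AEvent ends a₁ a₂ v), hQ0, hA0, hQ1, hA1]
  set c00 := prob (Function.update p e 0) (Z00 ends a₁ a₂ v y)
  set c01 := prob (Function.update p e 0) (Z01 ends a₁ a₂ v y)
  set c02 := prob (Function.update p e 0) (Z02 ends a₁ a₂ v y)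
  set c1n := prob (Function.update p e 0) (Z1n ends a₁ a₂ v y)
  set c12 := prob (Function.update p e 0) (Z12 ends a₁ a₂ v y)
  set c2n := prob (Function.update p e 0) (Z2n ends a₁ a₂ v y)
  set c21 := prob (Function.update p e 0) (Z21 ends a₁ a₂ v y)
  -- `A₀ Q₁ − A₁ Q₀ = (c₀₁ + c₀₂) Q − a (c₁₂ + c₂₁) ≥ 0` from the two brackets
  have hkey : 0 ≤ (c01 + c02 + c00) * (c00 + c01 + c02 + c1n + c2n) -
      c00 * (c1n + c12 + (c21 + c2n + (c01 + c02 + c00))) := by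
    have : (c01 + c02 + c00) * (c00 + c01 + c02 + c1n + c2n) -
        c00 * (c1n + c12 + (c21 + c2n + (c01 + c02 + c00))) =
        ((c2n + c21) * c01 - (c01 + c02 + c00) * c21) +
          ((c1n + c12) * c02 - (c01 + c02 + c00) * c12) +
          c01 * (c00 + c01 + c02 + c1n + c12) + c02 * (c00 + c01 + c02 + c2n + c21) := by
      ring
    rw [this]
    have t3 : 0 ≤ c01 * (c00 + c01 + c02 + c1n + c12) := by positivity
    have t4 : 0 ≤ c02 * (c00 + c01 + c02 + c2n + c21) := by positivity
    linarith
  have hts : 0 ≤ t - s := by linarith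
  have hid : (s * c00 + (1 - s) * (c01 + c02 + c00)) *
        (t * (c00 + c01 + c02 + c1n + c2n) + (1 - t) * (c1n + c12 + (c21 + c2n + (c01 + c02 + c00)))) -
      (t * c00 + (1 - t) * (c01 + c02 + c00)) *
        (s * (c00 + c01 + c02 + c1n + c2n) + (1 - s) * (c1n + c12 + (c21 + c2n + (c01 + c02 + c00)))) =
      (t - s) * ((c01 + c02 + c00) * (c00 + c01 + c02 + c1n + c2n) -
        c00 * (c1n + c12 + (c21 + c2n + (c01 + c02 + c00)))) := by
    ring
  linarith only [mul_nonneg hts hkey, hid]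

end Main

end PrefMono

end Summit.Ventures.PercRepro2
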